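import Summits.QuantumAdvantage.QuantumAdvantage.Theorems.CharDialTokenDialJ1
import HarnessLib

/-!
# WalkHardFJLinOdd — the token dial, part N3: the flip is a cell constant per (address, gap-residue) class

Cell `decomp-qadv`, lens 6, generation 19 (REV4 «FarFlipDial»).  Part J1 (`flip_iff_phi`) required the gap between every reader and
the swapped cut `t` to be frozen by the cell pattern.  Here the gap enters only through a RESIDUE ORACLE `gap : Fin (n+1) → ℕ`
(`gap g` = the number of ones of `u` in the window between `g` and `t`, mod `3`): the liveness of reader `g` at charge `c` is
`liveR t gap (addr c u t) g` as soon as `wseg u [g,t) % 3 = gap g` (`live_iff_liveR`) — for a NEAR reader the oracle value is read off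
the pattern, for a FAR reader it is the prescribed gap residue of the class (part N2's `classF`).  Consequently (`flip_iff_phiR`):
on a cell, for inputs whose reader gaps match the oracle, the win bit flips under the transposition iff `phiR … gap (addr c u t)`,
a charge-free function of (cell index, oracle, address class).  Reuses part J1's `nonreaders_eq`, `flc_split_readers`,
`card_add_card_mod_two` and part D2's `strat_before` / `strat_after`.
-/

set_option autoImplicit false

namespace Summit.QuantumAdvantage.AdviceFreeQNC0.JLinPeel.TokenDial

open Finset SegMove

variable {n : ℕ}

section FlipOracle

variable {p : ℕ} [hp : Fact p.Prime]

/-! ### §15 offsets and liveness from a gap-residue oracle -/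

/-- the relative offset of cut `g`'s address against cut `t`'s, from the gap residue `gap g`:
`(g − t) + gap g` for `g ≥ t`, `2·((t − g) + gap g)` for `g < t`. -/
def offR (t : Fin n) (gap : Fin (n + 1) → ℕ) (g : Fin (n + 1)) : ℕ :=
  if t.val ≤ g.val then (g.val - t.val) + gap g else 2 * ((t.val - g.val) + gap g)

/-- liveness of cut `g` BEFORE the swap when cut `t` sits at address class `r` (oracle form). -/
def liveR (t : Fin n) (gap : Fin (n + 1) → ℕ) (r : ℕ) (g : Fin (n + 1)) : Bool := decide ((r + offR t gap g) % 3 ≠ 0)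

/-- liveness of cut `g` AFTER the swap (oracle form): only cut `t`'s address moves. -/
def liveAR (s t : Fin n) (T : Finset (Fin n)) (gap : Fin (n + 1) → ℕ) (r : ℕ) (g : Fin (n + 1)) : Bool :=
  if g = cut t then decide ((r + (if patt T s = true then 2 else 1)) % 3 ≠ 0) else liveR t gap r g

/-- the live-fired indicator of reader `g` BEFORE the swap (oracle form). -/
def indBR (D : JLinData p n) (t : Fin n) (T : Finset (Fin n)) (V : Fin (n + 1) → ZMod p) (gap : Fin (n + 1) → ℕ) (r : ℕ)
    (g : Fin (n + 1)) : Bool :=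
  decB D T V g && liveR t gap r g

/-- the live-fired indicator of reader `g` AFTER the swap (oracle form). -/
def indAR (D : JLinData p n) (R : Finset (Fin (n + 1))) (s t : Fin n) (T : Finset (Fin n)) (V : Fin (n + 1) → ZMod p)
    (gap : Fin (n + 1) → ℕ) (r : ℕ) (g : Fin (n + 1)) : Bool :=
  decA D R s t T V g && liveAR s t T gap r g

/-- the FLIP TABLE (oracle form): does the win bit flip when cut `t` sits at class `r` and the reader gaps have residues `gap`? -/
def phiR (D : JLinData p n) (R : Finset (Fin (n + 1))) (s t : Fin n) (T : Finset (Fin n)) (V : Fin (n + 1) → ZMod p)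
    (gap : Fin (n + 1) → ℕ) (r : ℕ) : Bool :=
  decide ((R.filter fun g => indAR D R s t T V gap r g ≠ indBR D t T V gap r g).card % 2 = 1)

omit hp in
/-- **(liveness from the oracle).** if the window between `g` and `t` carries `gap g` ones mod `3`, cut `g` is live at charge `c`
iff `liveR` says so at the class `addr c u t`. -/
theorem live_iff_liveR (c : ℕ) (u : Fin n → Bool) (t : Fin n) (gap : Fin (n + 1) → ℕ) (g : Fin (n + 1))
    (hg : wseg u (min g.val t.val) (max g.val t.val) % 3 = gap g % 3) :
    (c + g.val + walkExp u g.val) % 3 ≠ 0 ↔ liveR t gap (addr c u t.val) g = true := by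
  unfold liveR offR
  rw [decide_eq_true_iff, addr_eq]
  by_cases hle : t.val ≤ g.val
  · rw [if_pos hle]
    have hw := walkExp_add_wseg u hle
    rw [min_eq_right hle, max_eq_left hle] at hg
    have : (c + g.val + walkExp u g.val) % 3 = ((c + t.val + walkExp u t.val) % 3 + (g.val - t.val + gap g)) % 3 := by omega
    rw [this]
  · rw [if_neg hle]
    rw [not_le] at hle
    have hw := walkExp_add_wseg u hle.le
    rw [min_eq_left hle.le, max_eq_right hle.le] at hg
    have : (c + g.val + walkExp u g.val) % 3
        = ((c + t.val + walkExp u t.val) % 3 + 2 * (t.val - g.val + gap g)) % 3 := by omega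
    rw [this]

/-- **(readers before, oracle form).** -/
theorem readers_beforeR (c : ℕ) (D : JLinData p n) (R : Finset (Fin (n + 1))) (O : Finset (Fin n)) (t : Fin n)
    (T : Finset (Fin n)) (V : Fin (n + 1) → ZMod p) (gap : Fin (n + 1) → ℕ) (u : Fin n → Bool)
    (hu : u ∈ cellM O (patt T) (formsOf D R) V) (hJO : ∀ g ∈ R, D.J g ⊆ O)
    (hgap : ∀ g ∈ R, wseg u (min g.val t.val) (max g.val t.val) % 3 = gap g % 3) :
    (R.filter fun g => D.strat g u = true ∧ (c + g.val + walkExp u g.val) % 3 ≠ 0)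
      = R.filter fun g => indBR D t T V gap (addr c u t.val) g = true := by
  refine filter_congr fun g hg => ?_
  unfold indBR
  rw [Bool.and_eq_true, strat_before D R O T V u hu g hg (hJO g hg), live_iff_liveR c u t gap g (hgap g hg)]

/-- **(readers after, oracle form).** the swap does not change any window count between a reader `g ≠ cut t` and `t`
(both swapped bits lie on the same side), so the same oracle serves after the swap. -/
theorem readers_afterR (c : ℕ) (D : JLinData p n) (R : Finset (Fin (n + 1))) (O : Finset (Fin n)) (s t : Fin n)
    (hst : t.val = s.val + 1) (hsO : s ∈ O) (htO : t ∈ O) (T : Finset (Fin n)) (V : Fin (n + 1) → ZMod p)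
    (gap : Fin (n + 1) → ℕ) (u : Fin n → Bool) (hu : u ∈ cellM O (patt T) (formsOf D R) V) (hne : u s ≠ u t)
    (hJO : ∀ g ∈ R, D.J g ⊆ O)
    (hgap : ∀ g ∈ R, wseg u (min g.val t.val) (max g.val t.val) % 3 = gap g % 3) :
    (R.filter fun g => D.strat g (segCompl u s.val (s.val + 2)) = true ∧
        (c + g.val + walkExp (segCompl u s.val (s.val + 2)) g.val) % 3 ≠ 0)
      = R.filter fun g => indAR D R s t T V gap (addr c u t.val) g = true := by
  have hpat := ((mem_cellM O (patt T) (formsOf D R) V u).1 hu).1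
  refine filter_congr fun g hg => ?_
  unfold indAR liveAR
  rw [Bool.and_eq_true, strat_after D R O s t hst hsO htO T V u hu hne g hg (hJO g hg)]
  by_cases hgt : g = cut t
  · rw [if_pos hgt, decide_eq_true_iff, hgt, cut_val, ← hpat s hsO,
      show (c + t.val + walkExp (segCompl u s.val (s.val + 2)) t.val) % 3 = addr c (segCompl u s.val (s.val + 2)) t.val
        from (addr_eq _ _ _).symm, hst, addr_swap_at c u s t hst hne]
  · rw [if_neg hgt]
    have hgv : g.val ≠ s.val + 1 := fun h => hgt (Fin.ext (by rw [cut_val]; omega))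
    rw [walkExp_swap_of_ne u s t hst hne hgv, live_iff_liveR c u t gap g (hgap g hg)]

/-- ★ **THE FLIP IS A CELL CONSTANT PER (ADDRESS, GAP) CLASS.** on a multi-form cell `(T, V)` over a pattern set `O ∋ s, t`
containing the juntas of the readers `R ∋ cut t`, with the strategy swap-stable outside `R` on the swap set: at ANY charge `c`, for an
input whose reader windows carry the oracle residues `gap`, the win bit flips under the transposition iff `phiR (T, V, gap) (addr c u t)`. -/
theorem flip_iff_phiR (c : ℕ) (D : JLinData p n) (R : Finset (Fin (n + 1))) (O : Finset (Fin n)) (s t : Fin n)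
    (hst : t.val = s.val + 1) (hsO : s ∈ O) (htO : t ∈ O) (htR : cut t ∈ R)
    (hS : ∀ g, g ∉ R → ∀ u : Fin n → Bool, u s ≠ u t → D.strat g (segCompl u s.val (s.val + 2)) = D.strat g u)
    (hJO : ∀ g ∈ R, D.J g ⊆ O) (T : Finset (Fin n)) (V : Fin (n + 1) → ZMod p) (gap : Fin (n + 1) → ℕ)
    (u : Fin n → Bool) (hu : u ∈ cellM O (patt T) (formsOf D R) V) (hne : u s ≠ u t)
    (hgap : ∀ g ∈ R, wseg u (min g.val t.val) (max g.val t.val) % 3 = gap g % 3) :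
    ringWinU c D.strat (segCompl u s.val (s.val + 2)) ≠ ringWinU c D.strat u ↔
      phiR D R s t T V gap (addr c u t.val) = true := by
  unfold phiR
  rw [decide_eq_true_iff, ringWinU_eq_decide, ringWinU_eq_decide, Ne, decide_eq_decide,
    flc_split_readers c D.strat R (segCompl u s.val (s.val + 2)), flc_split_readers c D.strat R u,
    nonreaders_eq c D R s t hst htR hS u hne, readers_beforeR c D R O t T V gap u hu hJO hgap,
    readers_afterR c D R O s t hst hsO htO T V gap u hu hne hJO hgap,
    ← card_add_card_mod_two R (indAR D R s t T V gap (addr c u t.val)) (indBR D t T V gap (addr c u t.val))]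
  constructor
  · intro h; omega
  · intro h; omega

/-- **(the oracle of a near reader).** if the window between `g` and `t` lies inside the pattern set, the window count of every
input of the cell is the pattern's. -/
theorem wseg_eq_patt_of_gap (O : Finset (Fin n)) (T : Finset (Fin n)) (u : Fin n → Bool) (hu : ∀ j ∈ O, u j = patt T j)
    (t : Fin n) (g : Fin (n + 1)) (hgap : ∀ i : Fin n, min g.val t.val ≤ i.val → i.val < max g.val t.val → i ∈ O) :
    wseg u (min g.val t.val) (max g.val t.val) = wseg (patt T) (min g.val t.val) (max g.val t.val) :=
  wseg_congr u (patt T) _ _ fun i h1 h2 => hu i (hgap i h1 h2)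

end FlipOracle

end Summit.QuantumAdvantage.AdviceFreeQNC0.JLinPeel.TokenDial
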